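import Mathlib

/-!
# EriceRemainderEnclosureHistoryAutonomyComparisonAgeCompositionUpwardChain — (E98a) route (N), first order, PURE: THE UPWARD CHAIN.
# The renewal system `ε_m = e_m − Σ_{l<Kw} A_m(l)·ε_{m+1+l}` with a TAIL kernel (`A_m(l)` non-increasing in the lag `l`, `A_m(0) ≤ 1`,
# `A_m(l) = 0` for `l ≥ Kw` — the shape of the aggregate first-order kernel `KA 1 m l = Σ_{k>l} c_k(m)` of EVERY profile) is EXACTLY the
# increment of the value function of a position-dependent UPWARD SKIP CHAIN: the tail sums `S_m = Σ_{q=m}^{N} ε_q` solve the POSITIVE UNIT-MASS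
# recursion `S_m = e_m + (1 − A_m(0))·S_{m+1} + Σ_l (A_m(l) − A_m(l+1))·S_{m+2+l}` (`tail_recursion`) — jump `+1` with probability `1 − A_m(0)`,
# jump `+(l+2)` with probability `A_m(l) − A_m(l+1)`; `S_m` is the expected excess collected along the chain started at `m`, `ε_m = S_m − S_{m+1}`.
# CONSEQUENCES.  §2 THE INTEGRATED END IS UNIVERSAL: `0 ≤ e_m ≤ Σ_{q=m}^{N} ε_q ≤ Σ_{q=m}^{N} e_q` at EVERY pin for EVERY such kernel and EVERY `e ≥ 0`
# (`tail_nonneg_le`; no monotonicity of `e`, no load condition, no separation).  §3 THE WINDOW LEMMA: if `ε ≥ 0` beyond the window `[s, s+k)` then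
# `Σ_{j<k} ε_{s+j} ≤ E·ψ(s)` for every bound `E ≥ e` on the window and every local SUPERSOLUTION `ψ ≥ 0` of the visit recursion on the window
# (`ψ(q) ≥ 1 + Σ_p P(q,p)ψ(p)`, `ψ = 0` off the window) — the expected number of visits of the chain to the window (`window_sum_le`).  §4 THE VISIT
# CRITERION: `Σ_l (A_m(l) − A_m(l+1))·ψ_{m,l}(m+1) ≤ 1` at every pin ⟹ `0 ≤ ε ≤ e` (`renewal_nonneg_of_visits`); with `ψ` = remaining length it is
# the row-mass criterion `Σ_l A_m(l) ≤ 1`; with the TWO-SPEED supersolution `(R + π)∕(1 + π)` (`π ≤ A_q(0)` on the window, `two_speed_supersolution`)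
# it is `Σ_k c_k(m)·(k + π_{m,k})∕(1 + π_{m,k}) ≤ 1` (`renewal_nonneg_two_speed`)

Cell `pub-balaban`, β-function sub-cell, BINDER row D4 «RemainderConst leaves for Bałaban's split» (`HOME/BINDER-OWNERS.md`; owner lineage `b2b-balaban-beta-an4`;
this file by co-owner #2 lineage `b2b-balaban-beta-d4-p2`, generation 86), β-FLOW TEAM duty (1), FREEZE (0) honoured (def-free; Mathlib only; nothing restated).

HONEST FRAMING (page 1, verbatim and binding).  *"Discharging BetaPertH makes Bałaban's UV stability UNCONDITIONAL — a real constructive-QFT result; it is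
NOT the continuum limit and NOT the Clay problem."*  THIS FILE DISCHARGES NOTHING OF THE KIND.  Elementary real algebra about ABSTRACT real sequences and a
triangular linear system — hypotheses of a census, not facts; the form, signs, ages and moments of Bałaban's (1.22) limit functional are NOT PRINTED ([I]
p. 298; GAPS G-t4-U2-1∕-2) and NOT asserted.  Row D4 class UNCHANGED (critical-path width 0; instance 0∕1; D4 DISCHARGE NO DATE).  HONEST DEPENDENCY:
continuum YM on T⁴ ⇐ BetaPertH ∧ nine spine estimates (0/9 proved); BetaPertH ⇐ (D1) ∧ (D4) ∧ CAP+tail; G-an2-4 gates asym, D1 and NE2/3/4.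

THE POINT (README `HOME/b2b-balaban-beta-d4-p2/g86/README.md`; a technique TRANSVERSE to the letters ∕ LP certificates ∕ cascades of (E71)–(E97)).  In the
constant-kernel case the system is the classical renewal equation read backwards and `ε_m = P(the chain started at m visits the horizon)` — a probability,
hence in `[0,1]` whatever the loads.  Along a flow the kernel varies with the pin; the representation survives exactly (`S` is the value function of the
inhomogeneous chain), positivity of `S` survives exactly (§2), and the END `0 ≤ S_m − S_{m+1} ≤ e_m` becomes «moving the start one step down adds between `0`
and `1` expected visits»; the frozen-kernel value `ε ≈ e∕(1 + X)` (`X = Σ_k k·c_k` the mean extra jump) is the renewal theorem.  What the END needs beyond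
§2 is an upper bound on the expected number of visits of the chain to each read's window — §3 makes that precise and §4 turns it into a criterion whose
trivial instance (every position is visited) is the light-load criterion of (E86i) and whose non-trivial instances discount each read by the jumps of the
YOUNGER ages inside its window.  The damped kernels of the self-consistent class are brought to tail form by the weights `Γ_q = Π_{t<q} g_t` ((E98b)).
NOT CLAIMED: the END for any new class of flows (the flow instances are (E98b)); anything printed — NOT B12 Thm 2, NOT BetaPertH, NOT continuum, NOT Clay.

WHAT IS PROVED ([folklore]; 0 `def`, 0 sorry; the kernel `A`, the reads `R v m = Σ_{l<Kw} A m l·v(m+1+l)` and the zero-tailed solution are displayed data).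
§1 `sum_mul_eq_sum_sub_mul_partial` (summation by parts), `tail_nonneg_of_anti`, `tail_split`, `tail_window`, **`tail_recursion`**.  §2 **`tail_nonneg_le`**
(THE UNIVERSAL INTEGRATED END).  §3 **`window_sum_le`**.  §4 **`renewal_nonneg_of_visits`** (THE VISIT CRITERION), `two_speed_supersolution`,
**`renewal_nonneg_two_speed`**.
-/
noncomputable section
open Finset

namespace Summit.QuantumFields.BalabanUV.Beta.EriceRemainderEnclosureHistoryAutonomyComparisonAgeCompositionUpwardChain

variable {Kw N : ℕ} {A : ℕ → ℕ → ℝ} {R : (ℕ → ℝ) → ℕ → ℝ} {e ε : ℕ → ℝ}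

/-! ## §1 Summation by parts; the tail sums and their recursion -/

/-- SUMMATION BY PARTS: `Σ_{l<n} f_l·g_l = Σ_{l<n} (f_l − f_{l+1})·(Σ_{j≤l} g_j) + f_n·Σ_{j<n} g_j`. [folklore] -/
theorem sum_mul_eq_sum_sub_mul_partial (f g : ℕ → ℝ) (n : ℕ) :
    ∑ l ∈ range n, f l * g l = ∑ l ∈ range n, (f l - f (l + 1)) * ∑ j ∈ range (l + 1), g j + f n * ∑ j ∈ range n, g j := by
  induction n with
  | zero => simp
  | succ n ih => rw [sum_range_succ, sum_range_succ, ih, sum_range_succ g n]; ring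

/-- A TAIL kernel (non-increasing in the lag, zero from the lag `Kw` on) is non-negative. [folklore] -/
theorem tail_nonneg_of_anti (hAanti : ∀ m l, A m (l + 1) ≤ A m l) (hAtop : ∀ m l, Kw ≤ l → A m l = 0) (m l : ℕ) : 0 ≤ A m l := by
  have key : ∀ d, 0 ≤ A m (Kw - d) := by
    intro d
    induction d with
    | zero => rw [hAtop m _ (by omega)]
    | succ d ih =>
      by_cases hd : Kw ≤ d
      · rw [show Kw - (d + 1) = Kw - d by omega]; exact ih
      · rw [show Kw - d = Kw - (d + 1) + 1 by omega] at ih; exact ih.trans (hAanti m _)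
  by_cases hl : Kw ≤ l
  · rw [hAtop m l hl]
  · simpa [show Kw - (Kw - l) = l by omega] using key (Kw - l)

/-- The tail sum splits off its first term: `S_q = ε_q + S_{q+1}` at every `q` (both sides vanish beyond the horizon). [folklore] -/
theorem tail_split (hεt : ∀ m, N < m → ε m = 0) {S : ℕ → ℝ} (hS : ∀ m, S m = ∑ q ∈ Ico m (N + 1), ε q) (q : ℕ) :
    S q = ε q + S (q + 1) := by
  by_cases hq : q ≤ N
  · rw [hS, hS, sum_eq_sum_Ico_succ_bot (by omega)]
  · rw [hS, hS, Ico_eq_empty (by omega), Ico_eq_empty (by omega), sum_empty, hεt q (by omega), add_zero]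

/-- Window sums are differences of tail sums: `Σ_{j<k} ε_{s+j} = S_s − S_{s+k}`. [folklore] -/
theorem tail_window (hεt : ∀ m, N < m → ε m = 0) {S : ℕ → ℝ} (hS : ∀ m, S m = ∑ q ∈ Ico m (N + 1), ε q) (s k : ℕ) :
    ∑ j ∈ range k, ε (s + j) = S s - S (s + k) := by
  induction k with
  | zero => simp
  | succ k ih => rw [sum_range_succ, ih, tail_split hεt hS (s + k), show s + (k + 1) = s + k + 1 by ring]; ring

/-- **THE TAIL RECURSION (the upward chain).**  For a tail kernel vanishing from the lag `Kw` on, reads `R v m = Σ_{l<Kw} A_m(l)·v(m+1+l)` and a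
zero-tailed solution of `ε_m = e_m − R ε m` (the two together force `e_m = 0` beyond `N`: the truncated excess), the tail sums `S_m = Σ_{q=m}^{N} ε_q`
satisfy, at every pin `m`,
`S_m = e_m + (1 − A_m(0))·S_{m+1} + Σ_{l<Kw} (A_m(l) − A_m(l+1))·S_{m+2+l}` — a recursion with NON-NEGATIVE coefficients of TOTAL MASS ONE when
`A_m` is non-increasing with `A_m(0) ≤ 1`: `S_m` is the expected excess collected by the upward chain (jump `+1` w.p. `1 − A_m(0)`, `+(l+2)` w.p.
`A_m(l) − A_m(l+1)`) started at `m` and stopped beyond `N`. [folklore] -/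
theorem tail_recursion (hAtop : ∀ m l, Kw ≤ l → A m l = 0) (hR : ∀ v m, R v m = ∑ l ∈ range Kw, A m l * v (m + 1 + l))
    (hεt : ∀ m, N < m → ε m = 0) (hrec : ∀ m, ε m = e m - R ε m)
    {S : ℕ → ℝ} (hS : ∀ m, S m = ∑ q ∈ Ico m (N + 1), ε q) (m : ℕ) :
    S m = e m + (1 - A m 0) * S (m + 1) + ∑ l ∈ range Kw, (A m l - A m (l + 1)) * S (m + 2 + l) := by
  have hsp := tail_split hεt hS
  -- the read in terms of tail sums
  have hread : R ε m = A m 0 * S (m + 1) + ∑ l ∈ range Kw, A m (l + 1) * S (m + 2 + l)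
      - ∑ l ∈ range Kw, A m l * S (m + 2 + l) := by
    rw [hR]
    have e1 : ∑ l ∈ range Kw, A m l * ε (m + 1 + l)
        = ∑ l ∈ range Kw, A m l * S (m + 1 + l) - ∑ l ∈ range Kw, A m l * S (m + 2 + l) := by
      rw [← sum_sub_distrib]
      exact sum_congr rfl fun l _ => by rw [hsp (m + 1 + l), show m + 1 + l + 1 = m + 2 + l by ring]; ring
    have e2 : ∑ l ∈ range Kw, A m l * S (m + 1 + l) = A m 0 * S (m + 1) + ∑ l ∈ range Kw, A m (l + 1) * S (m + 2 + l) := by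
      have : ∑ l ∈ range (Kw + 1), A m l * S (m + 1 + l) = ∑ l ∈ range Kw, A m l * S (m + 1 + l) := by
        rw [sum_range_succ, hAtop m Kw le_rfl, zero_mul, add_zero]
      rw [← this, sum_range_succ', add_comm, add_zero]
      congr 1
      exact sum_congr rfl fun l _ => by rw [show m + 1 + (l + 1) = m + 2 + l by ring]
    rw [e1, e2]
  rw [hsp m, hrec m, hread]
  have e3 : ∑ l ∈ range Kw, (A m l - A m (l + 1)) * S (m + 2 + l)
      = ∑ l ∈ range Kw, A m l * S (m + 2 + l) - ∑ l ∈ range Kw, A m (l + 1) * S (m + 2 + l) := by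
    rw [← sum_sub_distrib]; exact sum_congr rfl fun l _ => by ring
  rw [e3]; ring

/-- The coefficients of the tail recursion have total mass `1`: `(1 − A_m(0)) + Σ_{l<Kw} (A_m(l) − A_m(l+1)) = 1`. [folklore] -/
theorem tail_mass (hAtop : ∀ m l, Kw ≤ l → A m l = 0) (m : ℕ) :
    (1 - A m 0) + ∑ l ∈ range Kw, (A m l - A m (l + 1)) = 1 := by
  rw [sum_range_sub', hAtop m Kw le_rfl]; ring

/-! ## §2 The integrated END is universal -/

/-- **THE UNIVERSAL INTEGRATED END.**  Tail kernel (`A_m(l+1) ≤ A_m(l)`, `A_m(l) = 0` for `l ≥ Kw`, `A_m(0) ≤ 1`), ANY source `e ≥ 0` (no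
monotonicity), any horizon `N`: the zero-tailed solution of `ε_m = e_m − Σ_{l<Kw} A_m(l)·ε_{m+1+l}` satisfies, at EVERY pin,
`0 ≤ e_m ≤ Σ_{q=m}^{N} ε_q ≤ Σ_{q=m}^{N} e_q`.  (The value function of the upward chain collects at least the excess at its start and at most all of
it.)  No load condition: the row masses `Σ_l A_m(l)` may be arbitrarily large. [folklore] -/
theorem tail_nonneg_le (hAanti : ∀ m l, A m (l + 1) ≤ A m l) (hAtop : ∀ m l, Kw ≤ l → A m l = 0) (hA1 : ∀ m, A m 0 ≤ 1)
    (hR : ∀ v m, R v m = ∑ l ∈ range Kw, A m l * v (m + 1 + l)) (he0 : ∀ m, 0 ≤ e m)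
    (hεt : ∀ m, N < m → ε m = 0) (hrec : ∀ m, ε m = e m - R ε m) (m : ℕ) :
    0 ≤ ∑ q ∈ Ico m (N + 1), ε q ∧ e m ≤ ∑ q ∈ Ico m (N + 1), ε q ∧ ∑ q ∈ Ico m (N + 1), ε q ≤ ∑ q ∈ Ico m (N + 1), e q := by
  obtain ⟨S, hS⟩ : ∃ S : ℕ → ℝ, ∀ m, S m = ∑ q ∈ Ico m (N + 1), ε q := ⟨_, fun _ => rfl⟩
  obtain ⟨T, hT⟩ : ∃ T : ℕ → ℝ, ∀ m, T m = ∑ q ∈ Ico m (N + 1), e q := ⟨_, fun _ => rfl⟩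
  rw [← hS, ← hT]
  -- beyond the horizon the excess vanishes (the zero tail and the recursion together)
  have hez : ∀ q, N < q → e q = 0 := fun q hq => by
    have h1 := hrec q
    rw [hεt q hq, hR] at h1
    have : ∑ l ∈ range Kw, A q l * ε (q + 1 + l) = 0 := sum_eq_zero fun l _ => by rw [hεt _ (by omega), mul_zero]
    linarith
  suffices main0 : ∀ m, 0 ≤ S m ∧ S m ≤ T m by
    refine ⟨(main0 m).1, ?_, (main0 m).2⟩
    by_cases hmN : N < m
    · rw [hez m hmN]; exact (main0 m).1
    · rw [tail_recursion hAtop hR hεt hrec hS m]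
      have h1 : 0 ≤ (1 - A m 0) * S (m + 1) := mul_nonneg (sub_nonneg.mpr (hA1 m)) (main0 _).1
      have h2 : 0 ≤ ∑ l ∈ range Kw, (A m l - A m (l + 1)) * S (m + 2 + l) :=
        sum_nonneg fun l _ => mul_nonneg (sub_nonneg.mpr (hAanti m l)) (main0 _).1
      linarith
  intro m
  have hc0 : ∀ m l, 0 ≤ A m l - A m (l + 1) := fun m l => sub_nonneg.mpr (hAanti m l)
  have hTmono : ∀ p q, p ≤ q → T q ≤ T p := fun p q hpq => by
    rw [hT, hT]; exact sum_le_sum_of_subset_of_nonneg (Ico_subset_Ico_left hpq) fun i _ _ => he0 i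
  have hTsplit : ∀ q, q ≤ N → T q = e q + T (q + 1) := fun q hq => by rw [hT, hT, sum_eq_sum_Ico_succ_bot (by omega)]
  suffices main : ∀ n m, N < m + n → 0 ≤ S m ∧ S m ≤ T m from main (N + 1) m (by omega)
  intro n
  induction n with
  | zero =>
    intro m hm
    rw [hS, hT, Ico_eq_empty (by omega), sum_empty, sum_empty]
    exact ⟨le_rfl, le_rfl⟩
  | succ n ih =>
    intro m hm
    by_cases hmN : N < m
    · rw [hS, hT, Ico_eq_empty (by omega), sum_empty, sum_empty]
      exact ⟨le_rfl, le_rfl⟩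
    have hm' : m ≤ N := not_lt.mp hmN
    have hstep := tail_recursion hAtop hR hεt hrec hS m
    have ih1 := ih (m + 1) (by omega)
    have ihl : ∀ l, 0 ≤ S (m + 2 + l) ∧ S (m + 2 + l) ≤ T (m + 1) := fun l =>
      ⟨(ih (m + 2 + l) (by omega)).1, (ih (m + 2 + l) (by omega)).2.trans (hTmono _ _ (by omega))⟩
    have h1A : 0 ≤ 1 - A m 0 := sub_nonneg.mpr (hA1 m)
    constructor
    · rw [hstep]
      have : 0 ≤ ∑ l ∈ range Kw, (A m l - A m (l + 1)) * S (m + 2 + l) :=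
        sum_nonneg fun l _ => mul_nonneg (hc0 m l) (ihl l).1
      nlinarith [he0 m, ih1.1]
    · rw [hstep, hTsplit m hm']
      have hb : ∑ l ∈ range Kw, (A m l - A m (l + 1)) * S (m + 2 + l) ≤ (∑ l ∈ range Kw, (A m l - A m (l + 1))) * T (m + 1) := by
        rw [sum_mul]; exact sum_le_sum fun l _ => mul_le_mul_of_nonneg_left (ihl l).2 (hc0 m l)
      have hmass := tail_mass hAtop m
      nlinarith [ih1.2, mul_le_mul_of_nonneg_left ih1.2 h1A]

/-! ## §3 The window lemma: window sums against local visit supersolutions -/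

/-- **THE WINDOW LEMMA.**  Tail kernel as in §2; a window `[s, s+k)`; `ε ≥ 0` from `s + k` on (the END beyond the window); a bound `E ≥ 0` with
`e_q ≤ E` on the window; and a local SUPERSOLUTION of the visit recursion on the window: `ψ ≥ 0`, `ψ = 0` from `s + k` on, and
`1 + (1 − A_q(0))·ψ(q+1) + Σ_l (A_q(l) − A_q(l+1))·ψ(q+2+l) ≤ ψ(q)` for `s ≤ q < s + k` (so `ψ(q)` dominates the expected number of visits of the
upward chain to the window from `q`).  Then `Σ_{j<k} ε_{s+j} ≤ E·ψ(s)`.  Proof: `S_q ≤ E·ψ(q) + S_{s+k}` down the window by the tail recursion, the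
unit mass, and `S` non-increasing beyond the window. [folklore] -/
theorem window_sum_le (hAanti : ∀ m l, A m (l + 1) ≤ A m l) (hAtop : ∀ m l, Kw ≤ l → A m l = 0) (hA1 : ∀ m, A m 0 ≤ 1)
    (hR : ∀ v m, R v m = ∑ l ∈ range Kw, A m l * v (m + 1 + l))
    (hεt : ∀ m, N < m → ε m = 0) (hrec : ∀ m, ε m = e m - R ε m)
    {s k : ℕ} {E : ℝ} (hE : 0 ≤ E) (heE : ∀ q, s ≤ q → q < s + k → e q ≤ E) (hpos : ∀ q, s + k ≤ q → 0 ≤ ε q)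
    {ψ : ℕ → ℝ} (hψ0 : ∀ q, 0 ≤ ψ q) (hψoff : ∀ q, s + k ≤ q → ψ q = 0)
    (hψ : ∀ q, s ≤ q → q < s + k →
      1 + (1 - A q 0) * ψ (q + 1) + ∑ l ∈ range Kw, (A q l - A q (l + 1)) * ψ (q + 2 + l) ≤ ψ q) :
    ∑ j ∈ range k, ε (s + j) ≤ E * ψ s := by
  obtain ⟨S, hS⟩ : ∃ S : ℕ → ℝ, ∀ m, S m = ∑ q ∈ Ico m (N + 1), ε q := ⟨_, fun _ => rfl⟩
  have hsp := tail_split hεt hS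
  have hc0 : ∀ m l, 0 ≤ A m l - A m (l + 1) := fun m l => sub_nonneg.mpr (hAanti m l)
  -- beyond the window the tail sums do not increase
  have hfar : ∀ q, s + k ≤ q → S q ≤ S (s + k) := by
    intro q hq
    obtain ⟨d, rfl⟩ : ∃ d, q = s + k + d := ⟨q - (s + k), by omega⟩
    induction d with
    | zero => simp
    | succ d ih =>
      have h1 := hsp (s + k + d)
      have h2 := hpos (s + k + d) (by omega)
      have := ih (by omega)
      rw [show s + k + (d + 1) = s + k + d + 1 by ring]
      linarith
  -- down the window
  have hwin : ∀ d q, s + k ≤ q + d → s ≤ q → S q ≤ E * ψ q + S (s + k) := by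
    intro d
    induction d with
    | zero => intro q hq _; rw [hψoff q (by omega), mul_zero, zero_add]; exact hfar q (by omega)
    | succ d ih =>
      intro q hq hsq
      by_cases hqk : s + k ≤ q
      · rw [hψoff q hqk, mul_zero, zero_add]; exact hfar q hqk
      have hqk' : q < s + k := not_le.mp hqk
      by_cases hqN : N < q
      · have hSq : S q = 0 := by rw [hS, Ico_eq_empty (by omega), sum_empty]
        have hSk : S (s + k) = 0 := by rw [hS, Ico_eq_empty (by omega), sum_empty]
        rw [hSq, hSk, add_zero]; exact mul_nonneg hE (hψ0 q)
      have hstep := tail_recursion hAtop hR hεt hrec hS q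
      have ih1 : S (q + 1) ≤ E * ψ (q + 1) + S (s + k) := ih (q + 1) (by omega) (by omega)
      have ihl : ∀ l, S (q + 2 + l) ≤ E * ψ (q + 2 + l) + S (s + k) := fun l => ih (q + 2 + l) (by omega) (by omega)
      have h1A : 0 ≤ 1 - A q 0 := sub_nonneg.mpr (hA1 q)
      have hb : ∑ l ∈ range Kw, (A q l - A q (l + 1)) * S (q + 2 + l)
          ≤ ∑ l ∈ range Kw, (A q l - A q (l + 1)) * (E * ψ (q + 2 + l) + S (s + k)) :=
        sum_le_sum fun l _ => mul_le_mul_of_nonneg_left (ihl l) (hc0 q l)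
      have hsplit : ∑ l ∈ range Kw, (A q l - A q (l + 1)) * (E * ψ (q + 2 + l) + S (s + k))
          = E * ∑ l ∈ range Kw, (A q l - A q (l + 1)) * ψ (q + 2 + l) + (∑ l ∈ range Kw, (A q l - A q (l + 1))) * S (s + k) := by
        rw [mul_sum, sum_mul, ← sum_add_distrib]; exact sum_congr rfl fun l _ => by ring
      have hmass := tail_mass hAtop q
      have hsup := hψ q hsq hqk'
      have heq := heE q hsq hqk'
      have hm2 : ((1 - A q 0) + ∑ l ∈ range Kw, (A q l - A q (l + 1))) * S (s + k) = S (s + k) := by rw [hmass, one_mul]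
      have hx1 := mul_le_mul_of_nonneg_left ih1 h1A
      have hx2 := mul_le_mul_of_nonneg_left hsup hE
      calc S q = e q + (1 - A q 0) * S (q + 1) + ∑ l ∈ range Kw, (A q l - A q (l + 1)) * S (q + 2 + l) := hstep
        _ ≤ E + (1 - A q 0) * (E * ψ (q + 1) + S (s + k))
            + (E * ∑ l ∈ range Kw, (A q l - A q (l + 1)) * ψ (q + 2 + l)
              + (∑ l ∈ range Kw, (A q l - A q (l + 1))) * S (s + k)) := by rw [← hsplit]; linarith
        _ = E * (1 + (1 - A q 0) * ψ (q + 1) + ∑ l ∈ range Kw, (A q l - A q (l + 1)) * ψ (q + 2 + l))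
            + ((1 - A q 0) + ∑ l ∈ range Kw, (A q l - A q (l + 1))) * S (s + k) := by ring
        _ ≤ E * ψ q + S (s + k) := by rw [hm2]; linarith
  have hmain := hwin k s le_rfl le_rfl
  rw [tail_window hεt hS s k]
  linarith

/-! ## §4 The visit criterion -/

/-- **THE VISIT CRITERION FOR THE END.**  Tail kernel as in §2, `e ≥ 0` non-increasing, any horizon.  Suppose that for every pin `m` and every age
`l + 1 ≤ Kw` a local visit supersolution `ψ_{m,l}` on the window `[m+1, m+2+l)` is given (`ψ ≥ 0`, `= 0` from `m+2+l` on, supersolution inequality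
inside) with `Σ_{l<Kw} (A_m(l) − A_m(l+1))·ψ_{m,l}(m+1) ≤ 1`.  Then `0 ≤ ε ≤ e` at every pin.  (The read of the age `l+1` is its per-target weight
times a window sum, and the window sum is at most `e_{m+1}` times the expected number of visits of the chain to the window.)  With
`ψ_{m,l}(q) = m + 2 + l − q` (every position visited) the criterion is the row mass `Σ_l A_m(l) ≤ 1`. [folklore] -/
theorem renewal_nonneg_of_visits (hAanti : ∀ m l, A m (l + 1) ≤ A m l) (hAtop : ∀ m l, Kw ≤ l → A m l = 0) (hA1 : ∀ m, A m 0 ≤ 1)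
    (hR : ∀ v m, R v m = ∑ l ∈ range Kw, A m l * v (m + 1 + l)) (he0 : ∀ m, 0 ≤ e m) (hea : ∀ m, e (m + 1) ≤ e m)
    (hεt : ∀ m, N < m → ε m = 0) (hrec : ∀ m, ε m = e m - R ε m)
    {ψ : ℕ → ℕ → ℕ → ℝ} (hψ0 : ∀ m l q, 0 ≤ ψ m l q) (hψoff : ∀ m l q, m + 2 + l ≤ q → ψ m l q = 0)
    (hψ : ∀ m l q, l < Kw → m + 1 ≤ q → q < m + 2 + l →
      1 + (1 - A q 0) * ψ m l (q + 1) + ∑ i ∈ range Kw, (A q i - A q (i + 1)) * ψ m l (q + 2 + i) ≤ ψ m l q)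
    (hcrit : ∀ m, ∑ l ∈ range Kw, (A m l - A m (l + 1)) * ψ m l (m + 1) ≤ 1) : ∀ m, 0 ≤ ε m ∧ ε m ≤ e m := by
  have hA0 := tail_nonneg_of_anti hAanti hAtop
  have hc0 : ∀ m l, 0 ≤ A m l - A m (l + 1) := fun m l => sub_nonneg.mpr (hAanti m l)
  have hanti : Antitone e := antitone_nat_of_succ_le hea
  suffices step : ∀ m, (∀ q, m < q → 0 ≤ ε q ∧ ε q ≤ e q) → 0 ≤ ε m ∧ ε m ≤ e m by
    have main : ∀ n m, N < m + n → 0 ≤ ε m ∧ ε m ≤ e m := by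
      intro n
      induction n with
      | zero => intro m hm; rw [hεt m (by omega)]; exact ⟨le_rfl, he0 m⟩
      | succ n ih => intro m hm; exact step m fun q hq => ih q (by omega)
    exact fun m => main (N + 1) m (by omega)
  intro m IH
  have hRnn : 0 ≤ R ε m := by
    rw [hR]; exact sum_nonneg fun l _ => mul_nonneg (hA0 m l) (IH _ (by omega)).1
  -- the read by ages (summation by parts), each window sum against its supersolution
  have hparts : R ε m = ∑ l ∈ range Kw, (A m l - A m (l + 1)) * ∑ j ∈ range (l + 1), ε (m + 1 + j) := by
    rw [hR, sum_mul_eq_sum_sub_mul_partial (fun l => A m l) (fun l => ε (m + 1 + l)) Kw, hAtop m Kw le_rfl, zero_mul, add_zero]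
  have hwin : ∀ l ∈ range Kw, (A m l - A m (l + 1)) * ∑ j ∈ range (l + 1), ε (m + 1 + j)
      ≤ (A m l - A m (l + 1)) * (e (m + 1) * ψ m l (m + 1)) := by
    intro l hl
    refine mul_le_mul_of_nonneg_left ?_ (hc0 m l)
    exact window_sum_le hAanti hAtop hA1 hR hεt hrec (s := m + 1) (k := l + 1) (E := e (m + 1)) (he0 _)
      (fun q hq _ => hanti hq) (fun q hq => (IH q (by omega)).1) (hψ0 m l) (fun q hq => hψoff m l q (by omega))
      (fun q hq hqk => hψ m l q (mem_range.mp hl) hq (by omega))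
  have hRle : R ε m ≤ e (m + 1) := by
    calc R ε m ≤ ∑ l ∈ range Kw, (A m l - A m (l + 1)) * (e (m + 1) * ψ m l (m + 1)) := by rw [hparts]; exact sum_le_sum hwin
      _ = e (m + 1) * ∑ l ∈ range Kw, (A m l - A m (l + 1)) * ψ m l (m + 1) := by
          rw [mul_sum]; exact sum_congr rfl fun l _ => by ring
      _ ≤ e (m + 1) * 1 := mul_le_mul_of_nonneg_left (hcrit m) (he0 _)
      _ = e (m + 1) := mul_one _
  refine ⟨?_, by rw [hrec m]; linarith⟩
  rw [hrec m]
  linarith [hea m]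

/-- **THE TWO-SPEED SUPERSOLUTION.**  On a window `[s, s+k)` where the chain leaves every position by a jump `≥ 2` with probability at least `π ≥ 0`
(`π ≤ A_q(0)` for `s ≤ q < s+k`), the function `ψ(q) = (s + k − q + π)∕(1 + π)` (`0` from `s + k` on) is a local visit supersolution; at the
window's start `ψ(s) = (k + π)∕(1 + π)`. [folklore] -/
theorem two_speed_supersolution (hAanti : ∀ m l, A m (l + 1) ≤ A m l) (hAtop : ∀ m l, Kw ≤ l → A m l = 0)
    {s k : ℕ} {π : ℝ} (hπ0 : 0 ≤ π) (hπ : ∀ q, s ≤ q → q < s + k → π ≤ A q 0)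
    {ψ : ℕ → ℝ} (hψ : ∀ q, ψ q = if q < s + k then (((s + k : ℕ) : ℝ) - q + π) / (1 + π) else 0) :
    (∀ q, 0 ≤ ψ q) ∧ (∀ q, s + k ≤ q → ψ q = 0) ∧
    (∀ q, s ≤ q → q < s + k →
      1 + (1 - A q 0) * ψ (q + 1) + ∑ l ∈ range Kw, (A q l - A q (l + 1)) * ψ (q + 2 + l) ≤ ψ q) := by
  have hc0 : ∀ m l, 0 ≤ A m l - A m (l + 1) := fun m l => sub_nonneg.mpr (hAanti m l)
  have h1π : 0 < 1 + π := by linarith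
  have hψ0 : ∀ q, 0 ≤ ψ q := by
    intro q; rw [hψ]
    split_ifs with h
    · have : (q : ℝ) ≤ ((s + k : ℕ) : ℝ) := by exact_mod_cast h.le
      exact div_nonneg (by linarith) h1π.le
    · exact le_rfl
  refine ⟨hψ0, fun q hq => by rw [hψ, if_neg (by omega)], fun q hsq hqk => ?_⟩
  have hmass : ∑ l ∈ range Kw, (A q l - A q (l + 1)) = A q 0 := by rw [sum_range_sub', hAtop q Kw le_rfl, sub_zero]
  have hπq := hπ q hsq hqk
  have hψq : ψ q = (((s + k : ℕ) : ℝ) - q + π) / (1 + π) := by rw [hψ, if_pos hqk]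
  by_cases hk1 : q + 1 = s + k
  · -- last position of the window: every jump leaves
    have h1 : ψ (q + 1) = 0 := by rw [hψ, if_neg (by omega)]
    have h2 : ∀ l, ψ (q + 2 + l) = 0 := fun l => by rw [hψ, if_neg (by omega)]
    simp only [h1, h2, mul_zero, sum_const_zero, add_zero]
    rw [hψq, le_div_iff₀ h1π]
    have : ((s + k : ℕ) : ℝ) = (q : ℝ) + 1 := by rw [← hk1]; push_cast; ring
    rw [this]; linarith
  · have hq2 : q + 2 ≤ s + k := by omega
    -- bound every later value by the value two positions ahead
    set v : ℝ := (((s + k : ℕ) : ℝ) - (q + 2 : ℕ) + π) / (1 + π) with hv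
    have hv0 : 0 ≤ v := by
      have : ((q + 2 : ℕ) : ℝ) ≤ ((s + k : ℕ) : ℝ) := by exact_mod_cast hq2
      exact div_nonneg (by linarith) h1π.le
    have hlater : ∀ l, ψ (q + 2 + l) ≤ v := by
      intro l; rw [hψ]
      split_ifs with h
      · rw [hv]; refine div_le_div_of_nonneg_right ?_ h1π.le
        have : ((q + 2 : ℕ) : ℝ) ≤ ((q + 2 + l : ℕ) : ℝ) := by exact_mod_cast Nat.le_add_right _ _
        linarith
      · exact hv0
    have h1 : ψ (q + 1) = (((s + k : ℕ) : ℝ) - (q + 1 : ℕ) + π) / (1 + π) := by rw [hψ, if_pos (by omega)]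
    have hsum : ∑ l ∈ range Kw, (A q l - A q (l + 1)) * ψ (q + 2 + l) ≤ A q 0 * v := by
      rw [← hmass, sum_mul]; exact sum_le_sum fun l _ => mul_le_mul_of_nonneg_left (hlater l) (hc0 q l)
    have hψ1 : ψ (q + 1) = v + 1 / (1 + π) := by
      rw [h1, hv]; push_cast; field_simp; ring
    have hψq' : ψ q = v + 2 / (1 + π) := by
      rw [hψq, hv]; push_cast; field_simp; ring
    calc 1 + (1 - A q 0) * ψ (q + 1) + ∑ l ∈ range Kw, (A q l - A q (l + 1)) * ψ (q + 2 + l)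
        ≤ 1 + (1 - A q 0) * ψ (q + 1) + A q 0 * v := by linarith [hsum]
      _ = 1 + v + (1 - A q 0) * (1 / (1 + π)) := by rw [hψ1]; ring
      _ ≤ 1 + v + (1 - π) * (1 / (1 + π)) := by
          have : (1 - A q 0) * (1 / (1 + π)) ≤ (1 - π) * (1 / (1 + π)) :=
            mul_le_mul_of_nonneg_right (by linarith) (by positivity)
          linarith
      _ = ψ q := by rw [hψq']; field_simp; ring

/-- **THE TWO-SPEED CRITERION.**  Tail kernel as in §2, `e ≥ 0` non-increasing, any horizon.  If for every pin `m` and every age `k = l + 1 ≤ Kw`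
a number `0 ≤ π_{m,l} ≤ A_q(0)` for all `q` of the window `[m+1, m+1+k)` is given (a floor for the probability that the chain leaves a position of the
window by a jump `≥ 2`) with `Σ_{l<Kw} (A_m(l) − A_m(l+1))·(l + 1 + π_{m,l})∕(1 + π_{m,l}) ≤ 1`, then `0 ≤ ε ≤ e` at every pin.  With `π = 0` this is
the row-mass criterion `Σ_l A_m(l) ≤ 1`. [folklore] -/
theorem renewal_nonneg_two_speed (hAanti : ∀ m l, A m (l + 1) ≤ A m l) (hAtop : ∀ m l, Kw ≤ l → A m l = 0) (hA1 : ∀ m, A m 0 ≤ 1)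
    (hR : ∀ v m, R v m = ∑ l ∈ range Kw, A m l * v (m + 1 + l)) (he0 : ∀ m, 0 ≤ e m) (hea : ∀ m, e (m + 1) ≤ e m)
    (hεt : ∀ m, N < m → ε m = 0) (hrec : ∀ m, ε m = e m - R ε m)
    {π : ℕ → ℕ → ℝ} (hπ0 : ∀ m l, 0 ≤ π m l) (hπ : ∀ m l q, l < Kw → m + 1 ≤ q → q < m + 2 + l → π m l ≤ A q 0)
    (hcrit : ∀ m, ∑ l ∈ range Kw, (A m l - A m (l + 1)) * (((l : ℝ) + 1 + π m l) / (1 + π m l)) ≤ 1) :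
    ∀ m, 0 ≤ ε m ∧ ε m ≤ e m := by
  obtain ⟨ψ, hψ⟩ : ∃ ψ : ℕ → ℕ → ℕ → ℝ, ∀ m l q,
      ψ m l q = if q < m + 1 + (l + 1) then (((m + 1 + (l + 1) : ℕ) : ℝ) - q + π m l) / (1 + π m l) else 0 := ⟨_, fun _ _ _ => rfl⟩
  have hts : ∀ m l, l < Kw → (∀ q, 0 ≤ ψ m l q) ∧ (∀ q, m + 1 + (l + 1) ≤ q → ψ m l q = 0) ∧
      (∀ q, m + 1 ≤ q → q < m + 1 + (l + 1) →
        1 + (1 - A q 0) * ψ m l (q + 1) + ∑ i ∈ range Kw, (A q i - A q (i + 1)) * ψ m l (q + 2 + i) ≤ ψ m l q) :=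
    fun m l hl => two_speed_supersolution hAanti hAtop (s := m + 1) (k := l + 1) (hπ0 m l)
      (fun q hq hqk => hπ m l q hl hq (by omega)) (hψ m l)
  -- ages beyond Kw carry no weight: their ψ may be anything non-negative; use the same formula (π ≥ 0 keeps it ≥ 0)
  have hψ0 : ∀ m l q, 0 ≤ ψ m l q := by
    intro m l q; rw [hψ]
    split_ifs with h
    · have : (q : ℝ) ≤ ((m + 1 + (l + 1) : ℕ) : ℝ) := by exact_mod_cast h.le
      have := hπ0 m l
      exact div_nonneg (by linarith) (by linarith)
    · exact le_rfl
  refine renewal_nonneg_of_visits hAanti hAtop hA1 hR he0 hea hεt hrec (ψ := ψ) hψ0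
    (fun m l q hq => by rw [hψ, if_neg (by omega)]) (fun m l q hl hq hqk => ?_) (fun m => ?_)
  · exact (hts m l hl).2.2 q hq (by omega)
  · refine (sum_le_sum fun l hl => ?_).trans (hcrit m)
    have e1 : ψ m l (m + 1) = ((l : ℝ) + 1 + π m l) / (1 + π m l) := by
      rw [hψ, if_pos (by omega)]; push_cast; ring
    rw [e1]

end Summit.QuantumFields.BalabanUV.Beta.EriceRemainderEnclosureHistoryAutonomyComparisonAgeCompositionUpwardChain
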